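import Literature.Combinatorics.Optimization.ShellLawBulkSmoothness
import HarnessLib

/-!
# The window lower bound for a level-`1` shell law:
# `exp(−8(Λ+10)²/(β⁴(N−1)))/(2048·N²) ≤ law_S(2s+1,1; y₀)` for `|y₀ − s(2a+b)/N| ≤ Λ`

Cell pnp-psdrank (literature seat g35, on prover g24's (W3) specification; MEMO-26 §7 Step 6, LIT-51 §1:
"`coeff_hyperGen_window_lower` twice"). Fix a fixed-point-free involution `π` (a perfect matching), a
`π`-stable ground set `S` of `N` edges with `H`-type `(a,b,d)` (numbers of `HH`, mixed, `H̄H̄` edges),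
TYPE MARGINS `a, b, d ≥ βN + 1` (`0 < β ≤ 1/4`), a balanced number of full edges `βN ≤ s ≤ (4+β)N/8`, and
a reference point `y₀ ∈ ℕ` within `Λ` of `ν = s(2a+b)/N`. The level-`1` shell law `law_S(2s+1,1;·)` of the
block statistic `|U ∩ H|` is the mixture, over the half-vertex `v ∈ S` and the number `α` of `HH` edges
among the `s` full ones, of `C(a_v,α)·δ_{[v∈H]+2α} ∗ Hyp(b_v,d_v; s−α)` (`ShellLawGeneratingPolynomial` §3;
`(a_v,b_v,d_v)` the type of `S` with the edge of `v` stripped, `a_v + b_v + d_v = N − 1`).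

* **`shellLaw_one_window_lower`** — THE WINDOW LOWER BOUND: under the smallness hypotheses
  `Λ + 8 ≤ β²(N−1)/2` and `24 ≤ β₁⁴·βN` (`β₁ = β²/8`),
  `exp(−8(Λ+10)²/(β⁴(N−1)))/(2048·N²) ≤ law_S(2s+1,1;y₀)`.

Proof (prover g24's sketch = LIT-51 §1). ONE component of the mixture bounds the law from below
(`ShellLawPointwiseMixture.component_le_card_mul_shellLaw`: `C(a_v,α)·Hyp(b_v,d_v;s−α)_{y₀−[v∈H]−2α} ≤
|Shell_S(2s+1,1)|·law(y₀)`, `|Shell_S(2s+1,1)| = 2N·C(N−1,s)` by `card_shellIn_one`). Take any `v ∈ S` and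
choose `α = α*` by ROUNDING the centre equation: the centre of the component `(v,α)` is
`c(α) = [v∈H] + s·p + θ·α` with `p = b_v/(b_v+d_v)`, `θ = 2 − p ∈ [1,2]`, so `α* = ⌊(y₀ − [v∈H] − sp)/θ + 1/2⌋`
has `|y₀ − c(α*)| ≤ θ/2 ≤ 1`; and `c(ᾱ) = [v∈H] + s(2a_v+b_v)/(N−1)` at the mean `ᾱ = s·a_v/(N−1)` of the
`α`-mixing law `Hyp(a_v, b_v+d_v; s)`, which is within `5/2` of `ν`, so `|α* − ᾱ| ≤ Λ + 3`. Then
(i) the ATOM: the component `(v,α*)` is good with window half-width `2`, `ShellLawBulkSmoothness.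
good_component_numerics` (order `k = 0`) supplies the four window margins `≥ 6`, `V* ≥ β₁⁴βN` and
`η* ≤ 24/(β₁⁴βN) ≤ 1`, and `HypergeometricRatioWindow.coeff_hyperGen_window_lower` (`L = 2`, `n₀ = 4`) gives
`Hyp(b_v,d_v;r*)_{y} ≥ C(b_v+d_v,r*)·3/(8(2√V*+1))/16 ≥ C(b_v+d_v,r*)/(128√N)`;
(ii) the MIXING WEIGHT: the `α`-law `hyperGen a_v (b_v+d_v) s` has type margins `≥ β(N−1)`, hence window
margins `≥ β²(N−1) ≥ 2(Λ+8)` (`margins_ge_of_typeMargins`) and variance `≥ β⁴(N−1)` (`hypVar_ge`);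
`coeff_hyperGen_window_lower` (`L = Λ+3`, `n₀ = ⌈Λ⌉+5`) with `(1+η)^{n₀} ≤ e^{η n₀}`, `η ≤ 8(Λ+4)/(β⁴(N−1))`
gives `C(a_v,α*)·C(b_v+d_v,r*) ≥ C(N−1,s)·e^{−8(Λ+10)²/(β⁴(N−1))}/(8√N)`;
(iii) multiply: `law(y₀) ≥ e^{−8(Λ+10)²/(β⁴(N−1))}/(2·8·128·N²)`.

All PROVED, 0 sorry, no definitions, no named facts; constants crude and asymptotic only (the hypothesis
`24 ≤ β₁⁴βN` alone forces `N ≥ 24·8⁴/β⁹`). Consumed as a black box by prover g24's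
`ShellLawRelativeLevelSmoothness.relSmooth_of_hyps` (the `LB` hypothesis) towards Theorems brick 124 of
route `ChebyshevTracialDesign`; instrument/support material for the OPEN crux `TracialDecayExp20` — nothing
here is a statement about that crux, about psd rank, or about P vs NP.

## References
* [RollinRoss2010] A. Röllin, N. Ross, *Local limit theorems via Landau–Kolmogorov inequalities*,
  Bernoulli 21 (2015) 851–880, §4.1 Thm 4.2 (the variance scale of hypergeometric smoothness).
* [Rothvoss2017] T. Rothvoß, *The matching polytope has exponential extension complexity*, J. ACM 64
  (2017), §2 (PDF pp. 5–6): cuts, their partition by a perfect matching, the level classes.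
* [ChattamvelliShanmugam2020] R. Chattamvelli, R. Shanmugam, *Discrete Distributions in Engineering and the
  Applied Sciences* (2020), §7.4 Table 7.1 (hypergeometric recurrence, mode, mean, variance).
* [VatutinMikhailov1983] V. A. Vatutin, V. G. Mikhailov, *Limit theorems for the number of empty cells in an
  equiprobable scheme for group allocation of particles*, Theory Probab. Appl. 27 (1983) 734–743, §2.
-/

noncomputable section

open Finset Polynomial

namespace Literature.Combinatorics.Optimization

namespace ShellStep

open Literature.Combinatorics.StablePolynomials (hyperGen coeff_hyperGen coeff_hyperGen_nonneg eval_one_hyperGen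
  natDegree_hyperGen_le)
open Literature.Probability.Distributions.PoissonBinomial

variable {n : ℕ} {π : Fin n → Fin n}

/-! ### §1 Real-variable lemmas: rounding, the centre shift under stripping, crude variance bounds -/

/-- Rounding a nonnegative real to the nearest natural number: `|⌊t + 1/2⌋₊ − t| ≤ 1/2`. [folklore] -/
private theorem abs_floor_add_half_sub_le {t : ℝ} (ht : 0 ≤ t) :
    |((⌊t + 1 / 2⌋₊ : ℕ) : ℝ) - t| ≤ 1 / 2 := by
  have h1 : ((⌊t + 1 / 2⌋₊ : ℕ) : ℝ) ≤ t + 1 / 2 := Nat.floor_le (by linarith)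
  have h2 : t + 1 / 2 < ((⌊t + 1 / 2⌋₊ : ℕ) : ℝ) + 1 := Nat.lt_floor_add_one _
  rw [abs_le]; constructor <;> linarith

/-- **The centre shift under stripping one edge.** If `(a_Y, b_Y)` is obtained from `(a, b)` by lowering
the type by one edge (`a_Y ≤ a ≤ a_Y + 1`, `b_Y ≤ b ≤ b_Y + 1`, `2(a − a_Y) + (b − b_Y) ≤ 2`) with
`2a + b ≤ 2N`, then `|(2a+b)/N − (2a_Y+b_Y)/(N−1)| ≤ 2/(N−1)` (`N > 1`). [folklore] -/
private theorem abs_centre_shift_le {N a b aY bY : ℝ} (hN1 : 1 < N) (ha : aY ≤ a) (hb : bY ≤ b)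
    (hdrop : 2 * (a - aY) + (b - bY) ≤ 2) (ha0 : 0 ≤ aY) (hb0 : 0 ≤ bY) (hub : 2 * a + b ≤ 2 * N) :
    |(2 * a + b) / N - (2 * aY + bY) / (N - 1)| ≤ 2 / (N - 1) := by
  have hN0 : 0 < N := by linarith
  have hN1' : 0 < N - 1 := by linarith
  have key : (2 * a + b) / N - (2 * aY + bY) / (N - 1) =
      (N * (2 * (a - aY) + (b - bY)) - (2 * a + b)) / (N * (N - 1)) := by
    field_simp
    ring
  rw [key, abs_div, abs_of_pos (mul_pos hN0 hN1'), div_le_div_iff₀ (mul_pos hN0 hN1') hN1']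
  have hδ0 : 0 ≤ 2 * (a - aY) + (b - bY) := by linarith
  have hup : N * (2 * (a - aY) + (b - bY)) - (2 * a + b) ≤ 2 * N := by
    have := mul_le_mul_of_nonneg_left hdrop hN0.le
    nlinarith
  have hlo : -(2 * N) ≤ N * (2 * (a - aY) + (b - bY)) - (2 * a + b) := by
    have := mul_nonneg hN0.le hδ0
    linarith
  have habs : |N * (2 * (a - aY) + (b - bY)) - (2 * a + b)| ≤ 2 * N := abs_le.2 ⟨hlo, hup⟩
  calc |N * (2 * (a - aY) + (b - bY)) - (2 * a + b)| * (N - 1) ≤ 2 * N * (N - 1) :=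
        mul_le_mul_of_nonneg_right habs hN1'.le
    _ = 2 * (N * (N - 1)) := by ring

/-- **Crude upper bound for the hypergeometric variance**: `r b d (m−r)/(m²(m−1)) ≤ m` for `m = b + d ≥ 2`
(any real `r`). [cite: ChattamvelliShanmugam2020, §7.4 Table 7.1 (variance of the hypergeometric law)] -/
private theorem hypVar_le_sum {b d r : ℝ} (hb : 0 ≤ b) (hd : 0 ≤ d) (h2 : 2 ≤ b + d) :
    r * b * d * (b + d - r) / ((b + d) ^ 2 * (b + d - 1)) ≤ b + d := by
  have hm0 : 0 < b + d := by linarith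
  have hden : 0 < (b + d) ^ 2 * (b + d - 1) := mul_pos (pow_pos hm0 2) (by linarith)
  rw [div_le_iff₀ hden]
  have h1 : r * (b + d - r) ≤ (b + d) ^ 2 / 4 := by nlinarith [sq_nonneg (b + d - 2 * r)]
  have h2' : b * d ≤ (b + d) ^ 2 / 4 := by nlinarith [sq_nonneg (b - d)]
  have h3 : r * b * d * (b + d - r) = (r * (b + d - r)) * (b * d) := by ring
  have h4 : (r * (b + d - r)) * (b * d) ≤ ((b + d) ^ 2 / 4) * ((b + d) ^ 2 / 4) :=
    mul_le_mul h1 h2' (mul_nonneg hb hd) (by positivity)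
  have h5 : ((b + d) ^ 2 / 4) * ((b + d) ^ 2 / 4) ≤ (b + d) * ((b + d) ^ 2 * (b + d - 1)) := by
    have hm3 : 0 ≤ (b + d) ^ 3 := by positivity
    nlinarith
  rw [h3]; exact h4.trans h5

/-- `1/(8√N) ≤ 3/(8(2√V+1))` for `0 ≤ V ≤ N`, `1 ≤ N`. [folklore] -/
private theorem inv_sqrt_le_windowConst {V N : ℝ} (hV : V ≤ N) (hN : 1 ≤ N) :
    1 / (8 * Real.sqrt N) ≤ 3 / (8 * (2 * Real.sqrt V + 1)) := by
  have hsN : 1 ≤ Real.sqrt N := by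
    rw [show (1 : ℝ) = Real.sqrt 1 by simp]; exact Real.sqrt_le_sqrt hN
  have hsV : Real.sqrt V ≤ Real.sqrt N := Real.sqrt_le_sqrt hV
  have hV0 : 0 ≤ Real.sqrt V := Real.sqrt_nonneg _
  rw [div_le_div_iff₀ (by positivity) (by positivity)]
  nlinarith

/-- `(1 + η)^m ≤ exp(m·η)` for `η ≥ 0`. [folklore] -/
private theorem one_add_pow_le_exp_mul {η : ℝ} (hη : 0 ≤ η) (m : ℕ) : (1 + η) ^ m ≤ Real.exp (m * η) := by
  calc (1 + η) ^ m ≤ (Real.exp η) ^ m :=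
        pow_le_pow_left₀ (by linarith) (by linarith [Real.add_one_le_exp η]) m
    _ = Real.exp (m * η) := by rw [← Real.exp_nat_mul]

/-! ### §2 The two hypergeometric lower bounds and the centre numerics -/

/-- **The mixing-weight lower bound.** For the `α`-law `Hyp(a', m; s)` (`N' = a' + m ≥ 4`) with type margins
`a', m, s, N'−s ≥ βN'`, a window half-width `Λ + 3` with `2(Λ+4) ≤ β²N'`, an index `α*` with
`|α* − s·a'/N'| ≤ Λ + 3`, an exponent `Λ + 5 ≤ n₀ ≤ Λ + 6` and any `N ≥ max(N', 1)`:
`C(N',s)/(8√N) ≤ exp(8(Λ+10)²/(β⁴N'))·Hyp(a',m;s)_{α*}` — `coeff_hyperGen_window_lower` with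
`(1+η)^{n₀} ≤ e^{n₀η}`, `η ≤ 8(Λ+4)/(β⁴N')` (`hypVar_ge`), `3/(8(2√V+1)) ≥ 1/(8√N)`.
[cite: ChattamvelliShanmugam2020, §7.4 Table 7.1] [cite: RollinRoss2010, §4.1 Thm 4.2] -/
theorem mixingWeight_lower {a' m s αs n₀ : ℕ} {Λ β Nr : ℝ} (hβ : 0 < β) (hΛ0 : 0 ≤ Λ)
    (hN'4 : (4 : ℝ) ≤ (a' : ℝ) + m)
    (hma : β * ((a' : ℝ) + m) ≤ a') (hmm : β * ((a' : ℝ) + m) ≤ m) (hms : β * ((a' : ℝ) + m) ≤ s)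
    (hms' : (s : ℝ) + β * ((a' : ℝ) + m) ≤ (a' : ℝ) + m)
    (hLα : 2 * ((Λ + 3) + 1) ≤ β ^ 2 * ((a' : ℝ) + m))
    (hαwin : |(αs : ℝ) - (s : ℝ) * a' / ((a' : ℝ) + m)| ≤ Λ + 3)
    (hn₀ge : Λ + 3 + 2 ≤ (n₀ : ℝ)) (hn₀le : (n₀ : ℝ) ≤ Λ + 6)
    (hNr : (a' : ℝ) + m ≤ Nr) (hNr1 : 1 ≤ Nr) :
    (((a' + m).choose s : ℕ) : ℝ) * (1 / (8 * Real.sqrt Nr)) ≤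
      Real.exp (8 * (Λ + 10) ^ 2 / (β ^ 4 * ((a' : ℝ) + m))) * (hyperGen a' m s).coeff αs := by
  have hN'0 : (0 : ℝ) < (a' : ℝ) + m := by linarith only [hN'4]
  have hN'2 : (2 : ℝ) ≤ (a' : ℝ) + m := by linarith only [hN'4]
  obtain ⟨hM1, hM2, hM3, hM4⟩ := margins_ge_of_typeMargins (b := a') (d := m) (r := s) (β := β)
    (μ := (s : ℝ) * a' / ((a' : ℝ) + m)) hβ hma hmm hms hms' rfl
  have hV := hypVar_ge (b := (a' : ℝ)) (d := (m : ℝ)) (r := (s : ℝ)) hβ hN'2 hma hmm hms hms'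
  have hW := coeff_hyperGen_window_lower (b := a') (d := m) (r := s) (x := αs) (n₀ := n₀) (L := Λ + 3)
    rfl rfl rfl (by linarith only [hΛ0]) hαwin hn₀ge (hLα.trans hM1) (hLα.trans hM2) (hLα.trans hM3)
    (hLα.trans hM4)
  -- the variance and the window constant
  have hV0 : 0 < (s : ℝ) * a' * m * ((a' : ℝ) + m - s) / (((a' : ℝ) + m) ^ 2 * ((a' : ℝ) + m - 1)) :=
    lt_of_lt_of_le (mul_pos (pow_pos hβ 4) hN'0) hV
  have hWV : (s : ℝ) * a' * m * ((a' : ℝ) + m - s) / ((a' : ℝ) + m) ^ 2 =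
      ((a' : ℝ) + m - 1) *
        ((s : ℝ) * a' * m * ((a' : ℝ) + m - s) / (((a' : ℝ) + m) ^ 2 * ((a' : ℝ) + m - 1))) := by
    have h1 : (a' : ℝ) + m - 1 ≠ 0 := (show (0 : ℝ) < (a' : ℝ) + m - 1 by linarith only [hN'2]).ne'
    have h2 : (a' : ℝ) + m ≠ 0 := hN'0.ne'
    field_simp
  have hW0 : 0 < (s : ℝ) * a' * m * ((a' : ℝ) + m - s) / ((a' : ℝ) + m) ^ 2 := by
    rw [hWV]; exact mul_pos (by linarith only [hN'2]) hV0
  have hWge : ((a' : ℝ) + m - 1) * (β ^ 4 * ((a' : ℝ) + m)) ≤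
      (s : ℝ) * a' * m * ((a' : ℝ) + m - s) / ((a' : ℝ) + m) ^ 2 := by
    rw [hWV]; exact mul_le_mul_of_nonneg_left hV (by linarith only [hN'2])
  -- `η ≤ 8(Λ+4)/(β⁴N')`
  have hD0 : 0 < β ^ 4 * ((a' : ℝ) + m) := mul_pos (pow_pos hβ 4) hN'0
  have hη : 4 * ((a' : ℝ) + m + 2) * ((Λ + 3) + 1) /
      ((s : ℝ) * a' * m * ((a' : ℝ) + m - s) / ((a' : ℝ) + m) ^ 2) ≤ 8 * (Λ + 4) / (β ^ 4 * ((a' : ℝ) + m)) := by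
    rw [div_le_div_iff₀ hW0 hD0]
    have hK0 : 0 ≤ (Λ + 4) * (β ^ 4 * ((a' : ℝ) + m)) := mul_nonneg (by linarith only [hΛ0]) hD0.le
    have h48 : 4 * ((a' : ℝ) + m + 2) ≤ 8 * ((a' : ℝ) + m - 1) := by linarith only [hN'4]
    calc 4 * ((a' : ℝ) + m + 2) * ((Λ + 3) + 1) * (β ^ 4 * ((a' : ℝ) + m))
        = 4 * ((a' : ℝ) + m + 2) * ((Λ + 4) * (β ^ 4 * ((a' : ℝ) + m))) := by ring
      _ ≤ 8 * ((a' : ℝ) + m - 1) * ((Λ + 4) * (β ^ 4 * ((a' : ℝ) + m))) :=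
          mul_le_mul_of_nonneg_right h48 hK0
      _ = 8 * (Λ + 4) * (((a' : ℝ) + m - 1) * (β ^ 4 * ((a' : ℝ) + m))) := by ring
      _ ≤ 8 * (Λ + 4) * ((s : ℝ) * a' * m * ((a' : ℝ) + m - s) / ((a' : ℝ) + m) ^ 2) :=
          mul_le_mul_of_nonneg_left hWge (by linarith only [hΛ0])
  have hη0 : 0 ≤ 4 * ((a' : ℝ) + m + 2) * ((Λ + 3) + 1) /
      ((s : ℝ) * a' * m * ((a' : ℝ) + m - s) / ((a' : ℝ) + m) ^ 2) :=
    div_nonneg (mul_nonneg (by positivity) (by linarith only [hΛ0])) hW0.le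
  -- `(1+η)^{n₀} ≤ e^{8(Λ+10)²/(β⁴N')}`
  have hpow : (1 + 4 * ((a' : ℝ) + m + 2) * ((Λ + 3) + 1) /
      ((s : ℝ) * a' * m * ((a' : ℝ) + m - s) / ((a' : ℝ) + m) ^ 2)) ^ n₀ ≤
      Real.exp (8 * (Λ + 10) ^ 2 / (β ^ 4 * ((a' : ℝ) + m))) := by
    refine (one_add_pow_le_exp_mul hη0 n₀).trans (Real.exp_le_exp.2 ?_)
    have h1 : (n₀ : ℝ) * (4 * ((a' : ℝ) + m + 2) * ((Λ + 3) + 1) /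
        ((s : ℝ) * a' * m * ((a' : ℝ) + m - s) / ((a' : ℝ) + m) ^ 2)) ≤
        (Λ + 6) * (8 * (Λ + 4) / (β ^ 4 * ((a' : ℝ) + m))) :=
      mul_le_mul hn₀le hη hη0 (by linarith only [hΛ0])
    have h2 : (Λ + 6) * (8 * (Λ + 4) / (β ^ 4 * ((a' : ℝ) + m))) ≤
        8 * (Λ + 10) ^ 2 / (β ^ 4 * ((a' : ℝ) + m)) := by
      rw [mul_div_assoc', div_le_div_iff_of_pos_right hD0]
      nlinarith only [hΛ0]
    exact h1.trans h2
  -- `V ≤ N`, so `3/(8(2√V+1)) ≥ 1/(8√N)`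
  have hVN : (s : ℝ) * a' * m * ((a' : ℝ) + m - s) / (((a' : ℝ) + m) ^ 2 * ((a' : ℝ) + m - 1)) ≤ Nr :=
    (hypVar_le_sum (Nat.cast_nonneg _) (Nat.cast_nonneg _) hN'2).trans hNr
  have hc := inv_sqrt_le_windowConst hVN hNr1
  calc _ ≤ (((a' + m).choose s : ℕ) : ℝ) * (3 / (8 * (2 * Real.sqrt ((s : ℝ) * a' * m *
          ((a' : ℝ) + m - s) / (((a' : ℝ) + m) ^ 2 * ((a' : ℝ) + m - 1))) + 1))) :=
        mul_le_mul_of_nonneg_left hc (Nat.cast_nonneg _)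
    _ ≤ _ := hW
    _ ≤ _ := mul_le_mul_of_nonneg_right hpow (coeff_hyperGen_nonneg _ _ _ _)

/-- **The atom lower bound.** For `Hyp(b', d'; r)` (`m = b' + d' ≥ 2`) at an index `y` within `2` of the
mean, with the four window margins `≥ 6`, the window constant `η = 4(m+2)·3/W ≤ 1` (`W > 0`) and any
`N ≥ max(m, 1)`: `C(m,r)/(8√N) ≤ 16·Hyp(b',d';r)_y` — `coeff_hyperGen_window_lower` with `L = 2`, `n₀ = 4`,
`(1+η)^4 ≤ 16`, `3/(8(2√V+1)) ≥ 1/(8√N)`. (The hypotheses are stated in the shape delivered by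
`ShellLawBulkSmoothness.good_component_numerics` at order `k = 0`, half-width `L = 2`.)
[cite: ChattamvelliShanmugam2020, §7.4 Table 7.1] [cite: RollinRoss2010, §4.1 Thm 4.2] -/
theorem atom_lower {b' d' r y : ℕ} {Nr : ℝ}
    (hyw : |(y : ℝ) - (r : ℝ) * b' / ((b' : ℝ) + d')| ≤ 2)
    (hbm : 2 * (((2 : ℝ) + 0) + 1) ≤ (b' : ℝ) - (r : ℝ) * b' / ((b' : ℝ) + d'))
    (hrm : 2 * (((2 : ℝ) + 0) + 1) ≤ (r : ℝ) - (r : ℝ) * b' / ((b' : ℝ) + d'))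
    (hμm : 2 * (((2 : ℝ) + 0) + 1) ≤ (r : ℝ) * b' / ((b' : ℝ) + d'))
    (hdm : 2 * (((2 : ℝ) + 0) + 1) ≤ (d' : ℝ) - r + (r : ℝ) * b' / ((b' : ℝ) + d'))
    (hη1 : 4 * ((b' : ℝ) + d' + 2) * (((2 : ℝ) + 0) + 1) /
      ((r : ℝ) * b' * d' * ((b' : ℝ) + d' - r) / ((b' : ℝ) + d') ^ 2) ≤ 1)
    (hW0 : 0 < (r : ℝ) * b' * d' * ((b' : ℝ) + d' - r) / ((b' : ℝ) + d') ^ 2)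
    (hm2 : (2 : ℝ) ≤ (b' : ℝ) + d') (hmN : (b' : ℝ) + d' ≤ Nr) (hNr1 : 1 ≤ Nr) :
    (((b' + d').choose r : ℕ) : ℝ) * (1 / (8 * Real.sqrt Nr)) ≤ 16 * (hyperGen b' d' r).coeff y := by
  have hW := coeff_hyperGen_window_lower (b := b') (d := d') (r := r) (x := y) (n₀ := 4) (L := 2)
    rfl rfl rfl le_rfl hyw (by norm_num) (by linarith only [hbm]) (by linarith only [hrm])
    (by linarith only [hμm]) (by linarith only [hdm])
  have hη0 : 0 ≤ 4 * ((b' : ℝ) + d' + 2) * (2 + 1) /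
      ((r : ℝ) * b' * d' * ((b' : ℝ) + d' - r) / ((b' : ℝ) + d') ^ 2) := div_nonneg (by positivity) hW0.le
  have hη1' : 4 * ((b' : ℝ) + d' + 2) * (2 + 1) /
      ((r : ℝ) * b' * d' * ((b' : ℝ) + d' - r) / ((b' : ℝ) + d') ^ 2) ≤ 1 := by
    have e : ((2 : ℝ) + 0) + 1 = 2 + 1 := by norm_num
    rw [e] at hη1; exact hη1
  have hpow16 : (1 + 4 * ((b' : ℝ) + d' + 2) * (2 + 1) /
      ((r : ℝ) * b' * d' * ((b' : ℝ) + d' - r) / ((b' : ℝ) + d') ^ 2)) ^ 4 ≤ 16 := by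
    calc _ ≤ (2 : ℝ) ^ 4 := pow_le_pow_left₀ (by linarith only [hη0]) (by linarith only [hη1']) 4
      _ = 16 := by norm_num
  have hVN : (r : ℝ) * b' * d' * ((b' : ℝ) + d' - r) / (((b' : ℝ) + d') ^ 2 * ((b' : ℝ) + d' - 1)) ≤ Nr :=
    (hypVar_le_sum (Nat.cast_nonneg _) (Nat.cast_nonneg _) hm2).trans hmN
  have hc := inv_sqrt_le_windowConst hVN hNr1
  calc _ ≤ (((b' + d').choose r : ℕ) : ℝ) * (3 / (8 * (2 * Real.sqrt ((r : ℝ) * b' * d' *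
          ((b' : ℝ) + d' - r) / (((b' : ℝ) + d') ^ 2 * ((b' : ℝ) + d' - 1))) + 1))) :=
        mul_le_mul_of_nonneg_left hc (Nat.cast_nonneg _)
    _ ≤ _ := hW
    _ ≤ _ := mul_le_mul_of_nonneg_right hpow16 (coeff_hyperGen_nonneg _ _ _ _)

/-- **The centre numerics** (pure real arithmetic). With `m = b_Y + d_Y > 0`, `a_Y + m = N − 1`, the stripped
type one edge below `(a,b,d)`, `2a + b ≤ 2N`, `N ≥ 24`, `0 ≤ s ≤ 5N/8`, `0 ≤ h ≤ 1` and `|y₀ − s(2a+b)/N| ≤ Λ`: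
the slope `θ = (b_Y+2d_Y)/m` lies in `[1,2]` and equals `2 − b_Y/m`, and the real solution
`t = (y₀ − h − s·b_Y/m)/θ` of the centre equation `h + s·b_Y/m + θt = y₀` is within `Λ + 5/2` of the mean
`ᾱ = s·a_Y/(N−1)` of the `α`-law (because `c(ᾱ) = h + s(2a_Y+b_Y)/(N−1)` is within `5/2` of `s(2a+b)/N`).
[cite: Rothvoss2017, §2 (PDF p. 6)] -/
theorem centre_numerics {N a b aY bY dY mY s h y₀ Λ : ℝ} (hN24 : 24 ≤ N) (hm0 : 0 < bY + dY)
    (hbY0 : 0 ≤ bY) (hdY0 : 0 ≤ dY) (haY0 : 0 ≤ aY) (hmY : mY = bY + dY) (h7 : aY + mY = N - 1)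
    (haY2 : aY ≤ a) (hbY2 : bY ≤ b) (hdrop : 2 * (a - aY) + (b - bY) ≤ 2) (hub : 2 * a + b ≤ 2 * N)
    (hs0 : 0 ≤ s) (hs58 : s ≤ 5 * N / 8) (hh0 : 0 ≤ h) (hh1 : h ≤ 1)
    (hy : |y₀ - s * (2 * a + b) / N| ≤ Λ) :
    1 ≤ (bY + 2 * dY) / (bY + dY) ∧ (bY + 2 * dY) / (bY + dY) ≤ 2 ∧
      (bY + 2 * dY) / (bY + dY) = 2 - bY / (bY + dY) ∧
      h + s * bY / (bY + dY) + (bY + 2 * dY) / (bY + dY) * ((y₀ - h - s * bY / (bY + dY)) /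
        ((bY + 2 * dY) / (bY + dY))) = y₀ ∧
      |(y₀ - h - s * bY / (bY + dY)) / ((bY + 2 * dY) / (bY + dY)) - s * aY / (aY + mY)| ≤ Λ + 5 / 2 := by
  have hN1R : 0 < N - 1 := by linarith only [hN24]
  obtain ⟨θ, hθ⟩ : ∃ e : ℝ, e = (bY + 2 * dY) / (bY + dY) := ⟨_, rfl⟩
  rw [← hθ]
  have hθ1 : 1 ≤ θ := by rw [hθ, le_div_iff₀ hm0]; linarith only [hdY0]
  have hθ2 : θ ≤ 2 := by rw [hθ, div_le_iff₀ hm0]; linarith only [hbY0]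
  have hθ0 : 0 < θ := by linarith only [hθ1]
  have hθp : θ = 2 - bY / (bY + dY) := by rw [hθ]; field_simp; ring
  obtain ⟨t, ht⟩ : ∃ e : ℝ, e = (y₀ - h - s * bY / (bY + dY)) / θ := ⟨_, rfl⟩
  rw [← ht]
  have hct : h + s * bY / (bY + dY) + θ * t = y₀ := by rw [ht]; field_simp; ring
  -- `c(ᾱ) = h + s(2aY+bY)/(N−1)`
  have hcbar : h + s * bY / (bY + dY) + θ * (s * aY / (aY + mY)) = h + s * (2 * aY + bY) / (N - 1) := by
    rw [← h7, hθ, hmY]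
    have hden : aY + (bY + dY) ≠ 0 := by linarith only [haY0, hm0]
    field_simp
    ring
  -- `|y₀ − c(ᾱ)| ≤ Λ + 5/2`
  have hshift : |(2 * a + b) / N - (2 * aY + bY) / (N - 1)| ≤ 2 / (N - 1) :=
    abs_centre_shift_le (by linarith only [hN24]) haY2 hbY2 hdrop haY0 hbY0 hub
  have hdev : |y₀ - (h + s * (2 * aY + bY) / (N - 1))| ≤ Λ + 5 / 2 := by
    obtain ⟨X2, hX2⟩ : ∃ e : ℝ, e = s * ((2 * a + b) / N - (2 * aY + bY) / (N - 1)) := ⟨_, rfl⟩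
    have e2 : |X2| ≤ 3 / 2 := by
      rw [hX2, abs_mul, abs_of_nonneg hs0]
      calc s * |(2 * a + b) / N - (2 * aY + bY) / (N - 1)|
          ≤ (5 * N / 8) * (2 / (N - 1)) := mul_le_mul hs58 hshift (abs_nonneg _) (by linarith only [hs58, hs0])
        _ ≤ 3 / 2 := by
            rw [show (5 * N / 8) * (2 / (N - 1)) = (5 * N / 4) / (N - 1) by ring, div_le_iff₀ hN1R]
            linarith only [hN24]
    have e1 : y₀ - (h + s * (2 * aY + bY) / (N - 1)) = (y₀ - s * (2 * a + b) / N) + X2 - h := by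
      rw [hX2]; ring
    obtain ⟨hy1, hy2⟩ := abs_le.1 hy
    obtain ⟨hx1, hx2⟩ := abs_le.1 e2
    rw [e1, abs_le]; constructor <;> linarith only [hy1, hy2, hx1, hx2, hh0, hh1]
  have htbar : |t - s * aY / (aY + mY)| ≤ Λ + 5 / 2 := by
    have e : θ * (t - s * aY / (aY + mY)) = y₀ - (h + s * (2 * aY + bY) / (N - 1)) := by
      linear_combination hct - hcbar
    have h1 : |t - s * aY / (aY + mY)| ≤ |θ * (t - s * aY / (aY + mY))| := by
      rw [abs_mul, abs_of_pos hθ0]; exact le_mul_of_one_le_left (abs_nonneg _) hθ1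
    rw [e] at h1
    exact h1.trans hdev
  exact ⟨hθ1, hθ2, hθp, hct, htbar⟩

/-! ### §3 The window lower bound -/

section Main

variable (hπ : ∀ v, π (π v) = v) (hπ' : ∀ v, π v ≠ v)
include hπ hπ'

/-- **THE WINDOW LOWER BOUND FOR A LEVEL-`1` SHELL LAW.** Let `π` be a fixed-point-free involution, `S` a
`π`-stable ground set of `H`-type `(a,b,d)`, `a + b + d = N`, with type margins `a, b, d ≥ βN + 1`
(`0 < β ≤ 1/4`), `βN ≤ s ≤ (4+β)N/8`, and `y₀ ∈ ℕ` with `|y₀ − s(2a+b)/N| ≤ Λ`. If `Λ + 8 ≤ β²(N−1)/2` and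
`24 ≤ (β²/8)⁴·βN`, then `exp(−8(Λ+10)²/(β⁴(N−1)))/(2048·N²) ≤ law_S(2s+1,1;y₀)`.
(One vertex `v`, the component `(v, α*)` with `α*` rounding the centre equation (`centre_numerics`); the atom
through `atom_lower` on `ShellLawBulkSmoothness.good_component_numerics` (order `0`, half-width `2`), the mixing
weight `C(a_v,α*)C(b_v+d_v,s−α*)` through `mixingWeight_lower`; `component_le_card_mul_shellLaw` and
`|Shell_S(2s+1,1)| = 2N·C(N−1,s)`.)
[cite: RollinRoss2010, §4.1 Thm 4.2] [cite: Rothvoss2017, §2 (PDF p. 6)]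
[cite: ChattamvelliShanmugam2020, §7.4 Table 7.1] -/
theorem shellLaw_one_window_lower {S : Finset (Fin n)} (hS : ∀ v ∈ S, π v ∈ S) (H : Finset (Fin n))
    {a b d N : ℕ} (ha : (reps π (vAA π S H)).card = a) (hb : (reps π (vBH π S H ∪ vBN π S H)).card = b)
    (hd : (reps π (vDD π S H)).card = d) (hN : a + b + d = N)
    {β : ℝ} (hβ : 0 < β) (hβ4 : β ≤ 1 / 4)
    (haβ : β * N + 1 ≤ a) (hbβ : β * N + 1 ≤ b) (hdβ : β * N + 1 ≤ d)
    {s : ℕ} (hs : β * N ≤ s) (hs' : 8 * (s : ℝ) ≤ (4 + β) * N)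
    {y₀ : ℕ} {Λ : ℝ} (hy : |(y₀ : ℝ) - s * (2 * a + b) / N| ≤ Λ)
    (hΛ : Λ + 8 ≤ β ^ 2 * ((N : ℝ) - 1) / 2) (hsmall : 24 ≤ (β ^ 2 / 8) ^ 4 * (β * N)) :
    Real.exp (-(8 * (Λ + 10) ^ 2 / (β ^ 4 * ((N : ℝ) - 1)))) / (2048 * (N : ℝ) ^ 2) ≤
      shellLaw π S H (1 + 2 * s) 1 y₀ := by
  classical
  /- ───── 0. basic real bookkeeping ───── -/
  have hβ1 : β ≤ 1 := by linarith only [hβ4]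
  have hΛ0 : 0 ≤ Λ := (abs_nonneg _).trans hy
  have hβ₁0 : 0 < β ^ 2 / 8 := by positivity
  have hβ₁1 : β ^ 2 / 8 ≤ 1 := by nlinarith only [hβ, hβ1]
  have hβN24 : 24 ≤ β * (N : ℝ) := by
    have h1 : (β ^ 2 / 8) ^ 4 ≤ 1 := pow_le_one₀ hβ₁0.le hβ₁1
    have h2 : (β ^ 2 / 8) ^ 4 * (β * N) ≤ 1 * (β * N) :=
      mul_le_mul_of_nonneg_right h1 (by positivity)
    linarith only [h2, hsmall]
  have hβNN : β * (N : ℝ) ≤ N := by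
    have := mul_le_mul_of_nonneg_right hβ1 (Nat.cast_nonneg N); linarith only [this]
  have hN24 : (24 : ℝ) ≤ N := by linarith only [hβN24, hβNN]
  have hNR0 : (0 : ℝ) < N := by linarith only [hN24]
  have hN1R : (0 : ℝ) < (N : ℝ) - 1 := by linarith only [hN24]
  have hβNe : β * (N : ℝ) = β * ((N : ℝ) - 1) + β := by ring
  have hβN4 : β * (N : ℝ) ≤ N / 4 := by
    have := mul_le_mul_of_nonneg_right hβ4 (Nat.cast_nonneg N); linarith only [this]
  -- `|S| = 2N`, hence `S` is nonempty
  have hcardS : S.card = 2 * N := by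
    have := two_mul_typeReps_eq_card hπ hπ' hS H
    rw [ha, hb, hd] at this; omega
  have hN1 : 1 ≤ N := by exact_mod_cast (show (1 : ℝ) ≤ N by linarith only [hN24])
  obtain ⟨v, hv⟩ : S.Nonempty := card_pos.1 (by omega)
  /- ───── 1. the half-set `{v}` and the stripped types ───── -/
  have hY : ({v} : Finset (Fin n)) ∈ halfSets π S 1 := by
    rw [halfSets_one_eq_image hπ' S]; exact mem_image_of_mem _ hv
  obtain ⟨h1, h2, h3, h4, h5, h6, h7⟩ := strip_one_types hπ hπ' hS H hY
  rw [ha] at h1 h2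
  rw [hb] at h3 h4
  rw [hd] at h5 h6
  rw [ha, hb, hd] at h7
  obtain ⟨aY, haY⟩ : ∃ e, (reps π (vAA π (strip π S {v}) H)).card = e := ⟨_, rfl⟩
  obtain ⟨bY, hbY⟩ : ∃ e, (reps π (vBH π (strip π S {v}) H ∪ vBN π (strip π S {v}) H)).card = e := ⟨_, rfl⟩
  obtain ⟨dY, hdY⟩ : ∃ e, (reps π (vDD π (strip π S {v}) H)).card = e := ⟨_, rfl⟩
  rw [haY] at h1 h2 h7
  rw [hbY] at h3 h4 h7
  rw [hdY] at h5 h6 h7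
  obtain ⟨hv0, hσ⟩ : ∃ e, (({v} : Finset (Fin n)) ∩ H).card = e := ⟨_, rfl⟩
  have hh1 : hv0 ≤ 1 := by
    rw [← hσ]; exact (card_le_card inter_subset_left).trans (card_singleton v).le
  obtain ⟨mY, hmY⟩ : ∃ e : ℕ, e = bY + dY := ⟨_, rfl⟩
  -- real casts of the type data
  have hNsum : (a : ℝ) + b + d = N := by exact_mod_cast hN
  have h7R : (aY : ℝ) + mY = (N : ℝ) - 1 := by
    have : ((aY + (bY + dY) + 1 : ℕ) : ℝ) = ((a + (b + d) : ℕ) : ℝ) := by rw [h7]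
    push_cast at this
    rw [hmY]; push_cast; linarith only [this, hNsum]
  have hmYR : (mY : ℝ) = (bY : ℝ) + dY := by rw [hmY]; push_cast; ring
  have haY1 : (a : ℝ) ≤ aY + 1 := by exact_mod_cast h1
  have haY2 : (aY : ℝ) ≤ a := by exact_mod_cast h2
  have hbY1 : (b : ℝ) ≤ bY + 1 := by exact_mod_cast h3
  have hbY2 : (bY : ℝ) ≤ b := by exact_mod_cast h4
  have hdY1 : (d : ℝ) ≤ dY + 1 := by exact_mod_cast h5
  have hdY2 : (dY : ℝ) ≤ d := by exact_mod_cast h6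
  have hdrop : 2 * ((a : ℝ) - aY) + ((b : ℝ) - bY) ≤ 2 := by
    have : 2 * (a - aY) + (b - bY) ≤ 2 := by omega
    have h' : ((2 * (a - aY) + (b - bY) : ℕ) : ℝ) ≤ 2 := by exact_mod_cast this
    push_cast [Nat.cast_sub h2, Nat.cast_sub h4] at h'
    linarith only [h']
  have haYβ : β * ((N : ℝ) - 1) ≤ aY := by linarith only [haβ, haY1, hβNe, hβ.le]
  have hbY0 : β * (N : ℝ) ≤ bY := by linarith only [hbβ, hbY1]
  have hdY0 : β * (N : ℝ) ≤ dY := by linarith only [hdβ, hdY1]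
  have hm0 : (0 : ℝ) < (bY : ℝ) + dY := by linarith only [hbY0, hdY0, hβN24]
  have hmYβ : β * ((N : ℝ) - 1) ≤ mY := by rw [hmYR]; linarith only [hbY0, hdY0, hβNe, hβ.le, hβN24]
  have hsβ' : β * ((N : ℝ) - 1) ≤ s := by linarith only [hs, hβNe, hβ.le]
  have hs58 : (s : ℝ) ≤ 5 * N / 8 := by linarith only [hs', hβNN]
  have hsN' : (s : ℝ) + β * ((N : ℝ) - 1) ≤ (N : ℝ) - 1 := by
    linarith only [hs', hβN4, hβNe, hβ.le, hN24]
  have hN'4 : (4 : ℝ) ≤ (aY : ℝ) + mY := by linarith only [h7R, hN24]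
  have hsle : s ≤ aY + mY := by
    have : (s : ℝ) ≤ (aY : ℝ) + mY := by
      rw [h7R]; linarith only [hsN', mul_nonneg hβ.le hN1R.le]
    exact_mod_cast this
  /- ───── 2. the centre equation and the rounded index `α*` ───── -/
  obtain ⟨hθ1, hθ2, hθp, hct, htbar⟩ := centre_numerics (N := (N : ℝ)) (a := a) (b := b) (aY := aY)
    (bY := bY) (dY := dY) (mY := mY) (s := s) (h := hv0) (y₀ := y₀) (Λ := Λ) hN24 hm0 (Nat.cast_nonneg _)
    (Nat.cast_nonneg _) (Nat.cast_nonneg _) hmYR h7R haY2 hbY2 hdrop (by linarith only [hNsum, (Nat.cast_nonneg d : (0 : ℝ) ≤ d)])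
    (Nat.cast_nonneg _) hs58 (Nat.cast_nonneg _) (by exact_mod_cast hh1) hy
  generalize hθ : ((bY : ℝ) + 2 * dY) / ((bY : ℝ) + dY) = θ at hθ1 hθ2 hθp hct htbar
  generalize ht : ((y₀ : ℝ) - hv0 - (s : ℝ) * bY / ((bY : ℝ) + dY)) / θ = t at hct htbar
  have hθ0 : 0 < θ := by linarith only [hθ1]
  -- window data of the `α`-law `Hyp(aY, mY; s)`
  have hLα : 2 * ((Λ + 3) + 1) ≤ β ^ 2 * ((aY : ℝ) + mY) :=
    calc 2 * ((Λ + 3) + 1) ≤ β ^ 2 * ((N : ℝ) - 1) := by linarith only [hΛ]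
      _ = β ^ 2 * ((aY : ℝ) + mY) := by rw [h7R]
  obtain ⟨hMα1, hMα2, hMα3, hMα4⟩ := margins_ge_of_typeMargins (b := aY) (d := mY) (r := s) (β := β)
    (μ := (s : ℝ) * aY / ((aY : ℝ) + mY)) hβ (by rw [h7R]; exact haYβ) (by rw [h7R]; exact hmYβ)
    (by rw [h7R]; exact hsβ') (by rw [h7R]; exact hsN') rfl
  -- `ᾱ ≥ 2(Λ+8)`, so `t ≥ 0` and the rounding `α* = ⌊t + 1/2⌋₊` is honest
  have ht0 : 0 ≤ t := by
    obtain ⟨ht1, _⟩ := abs_le.1 htbar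
    linarith only [ht1, hMα3, hLα, hΛ0]
  obtain ⟨αs, hαs⟩ : ∃ e : ℕ, e = ⌊t + 1 / 2⌋₊ := ⟨_, rfl⟩
  have hround : |(αs : ℝ) - t| ≤ 1 / 2 := by rw [hαs]; exact abs_floor_add_half_sub_le ht0
  have hαwin : |(αs : ℝ) - (s : ℝ) * aY / ((aY : ℝ) + mY)| ≤ Λ + 3 := by
    have := abs_sub_le (αs : ℝ) t ((s : ℝ) * aY / ((aY : ℝ) + mY))
    linarith only [this, hround, htbar]
  obtain ⟨-, hαs2, -⟩ := window_support hαwin (hLα.trans hMα1) (hLα.trans hMα2) (hLα.trans hMα4)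
  have hαss : αs ≤ s := by omega
  /- ───── 3. the mixing weight ───── -/
  obtain ⟨n₀, hn₀⟩ : ∃ e : ℕ, e = ⌈Λ⌉₊ + 5 := ⟨_, rfl⟩
  have hn₀ge : Λ + 3 + 2 ≤ (n₀ : ℝ) := by
    rw [hn₀]; push_cast; linarith only [Nat.le_ceil Λ]
  have hn₀le : (n₀ : ℝ) ≤ Λ + 6 := by
    rw [hn₀]; push_cast; linarith only [Nat.ceil_lt_add_one hΛ0]
  have hA := mixingWeight_lower (Nr := (N : ℝ)) hβ hΛ0 hN'4 (by rw [h7R]; exact haYβ) (by rw [h7R]; exact hmYβ)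
    (by rw [h7R]; exact hsβ') (by rw [h7R]; exact hsN') hLα hαwin hn₀ge hn₀le (by linarith only [h7R])
    (by linarith only [hN24])
  rw [h7R, coeff_hyperGen, if_pos hαss] at hA
  /- ───── 4. the atom: the component `({v}, α*)` is good with window half-width `2` ───── -/
  obtain ⟨r, hr⟩ : ∃ e : ℕ, e = s - αs := ⟨_, rfl⟩
  have hrR : (r : ℝ) = s - αs := by rw [hr]; push_cast [Nat.cast_sub hαss]; ring
  -- the centre of the component is within `θ/2 ≤ 1` of `y₀`
  have hcen : (y₀ : ℝ) - hv0 - 2 * ((s : ℝ) - r) - (r : ℝ) * bY / ((bY : ℝ) + dY) = θ * (t - αs) := by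
    have hct' := hct
    rw [hθp] at hct' ⊢
    rw [hrR]
    linear_combination (-1 : ℝ) * hct'
  have hgood : |(y₀ : ℝ) - hv0 - 2 * ((s : ℝ) - r) - (r : ℝ) * bY / ((bY : ℝ) + dY)| ≤ 2 := by
    rw [hcen, abs_mul, abs_of_pos hθ0]
    have : |t - (αs : ℝ)| ≤ 1 / 2 := by rw [abs_sub_comm]; exact hround
    calc θ * |t - (αs : ℝ)| ≤ 2 * (1 / 2) := mul_le_mul hθ2 this (abs_nonneg _) (by norm_num)
      _ ≤ 2 := by norm_num
  -- the smallness hypotheses of `good_component_numerics` at order `k = 0`, half-width `L = 2`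
  have hL1 : 2 + 0 + Λ ≤ β * s := by
    have h1 : β * (β * (N : ℝ)) ≤ β * s := mul_le_mul_of_nonneg_left hs hβ.le
    have e : β * (β * (N : ℝ)) = β ^ 2 * ((N : ℝ) - 1) + β ^ 2 := by ring
    have hp : 0 ≤ β ^ 2 * ((N : ℝ) - 1) := mul_nonneg (sq_nonneg β) hN1R.le
    linarith only [h1, e, hΛ, sq_nonneg β, hp]
  have hL2 : 2 + 0 + Λ + 3 ≤ β * N / 8 := by
    have hb1 : β * β ≤ β * (1 / 4) := mul_le_mul_of_nonneg_left hβ4 hβ.le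
    have hb2 : β ^ 2 ≤ β / 4 := by rw [pow_two]; linarith only [hb1]
    have h3 : β ^ 2 * ((N : ℝ) - 1) ≤ β / 4 * ((N : ℝ) - 1) := mul_le_mul_of_nonneg_right hb2 hN1R.le
    have e : β / 4 * ((N : ℝ) - 1) = β * N / 4 - β / 4 := by ring
    linarith only [hΛ, h3, e, hβ.le]
  have hwin : 2 * (2 + 0 + 1) ≤ (β ^ 2 / 8) ^ 2 * (β * N) := by
    have h1 : (β ^ 2 / 8) ^ 4 ≤ (β ^ 2 / 8) ^ 2 := pow_le_pow_of_le_one hβ₁0.le hβ₁1 (by norm_num)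
    have h2 := mul_le_mul_of_nonneg_right h1 (show 0 ≤ β * (N : ℝ) by positivity)
    linarith only [h2, hsmall]
  obtain ⟨hbm, hrm, hμm, hdm, -, hηle, hW0, -, hmN, hyσ⟩ :=
    good_component_numerics (N := (N : ℝ)) (a := a) (b := b) (d := d) (bY := (bY : ℝ))
      (dY := (dY : ℝ)) (s := s) (r := (r : ℝ)) (h := (hv0 : ℝ)) (y₀ := y₀) (L := 2) (Λ := Λ) (β := β) (k := 0)
      hβ hβ1 hNsum (Nat.cast_nonneg _) hbβ hdβ (by linarith only [hbY1]) hbY2 (by linarith only [hdY1]) hdY2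
      hs hs' (Nat.cast_nonneg _) (Nat.cast_nonneg _) (by exact_mod_cast hh1) le_rfl hy hgood (by norm_num)
      hL1 hL2 hwin (by linarith only [hβN24])
  -- the local index `y = y₀ − hv0 − 2α*`
  have hσle : hv0 + 2 * αs ≤ y₀ := by
    have h' : (hv0 : ℝ) + 2 * ((s : ℝ) - r) + 0 ≤ y₀ := hyσ
    rw [hrR] at h'
    have : ((hv0 + 2 * αs : ℕ) : ℝ) ≤ (y₀ : ℝ) := by push_cast; linarith only [h']
    exact_mod_cast this
  obtain ⟨y, hyy⟩ : ∃ y : ℕ, y₀ = hv0 + 2 * αs + y := ⟨y₀ - (hv0 + 2 * αs), by omega⟩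
  have hyR : (y : ℝ) = (y₀ : ℝ) - hv0 - 2 * αs := by
    have : (y₀ : ℝ) = ((hv0 + 2 * αs + y : ℕ) : ℝ) := by rw [← hyy]
    push_cast at this; linarith only [this]
  have hyw : |(y : ℝ) - (r : ℝ) * bY / ((bY : ℝ) + dY)| ≤ 2 := by
    have e : (y : ℝ) - (r : ℝ) * bY / ((bY : ℝ) + dY) =
        (y₀ : ℝ) - hv0 - 2 * ((s : ℝ) - r) - (r : ℝ) * bY / ((bY : ℝ) + dY) := by rw [hyR, hrR]; ring
    rw [e]; exact hgood
  have hη1 : 4 * ((bY : ℝ) + dY + 2) * (((2 : ℝ) + 0) + 1) /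
      ((r : ℝ) * bY * dY * ((bY : ℝ) + dY - r) / ((bY : ℝ) + dY) ^ 2) ≤ 1 := by
    refine hηle.trans ?_
    rw [div_le_one (by positivity)]; linarith only [hsmall]
  have hV2 : (2 : ℝ) ≤ (bY : ℝ) + dY := by linarith only [hbY0, hdY0, hβN24]
  have hB := atom_lower (Nr := (N : ℝ)) hyw hbm hrm hμm hdm hη1 hW0 hV2 hmN (by linarith only [hN24])
  rw [← hmY] at hB
  /- ───── 5. one component bounds the law from below; bookkeeping ───── -/
  have hcomp := component_le_card_mul_shellLaw hπ hπ' hS H 1 s hY hαss (y₀ := y₀) (by rw [hσ]; exact hσle)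
  rw [haY, hbY, hdY, hσ, ← hr, show y₀ - (hv0 + 2 * αs) = y by omega] at hcomp
  have hcard : ((shellIn π S (1 + 2 * s) 1).card : ℝ) = 2 * N * (((aY + mY).choose s : ℕ) : ℝ) := by
    rw [card_shellIn_one hπ hπ' S hS s, hcardS, show 2 * N / 2 - 1 = aY + mY by omega]
    push_cast; ring
  rw [hcard] at hcomp
  have hCα0 : (0 : ℝ) < (((aY + mY).choose s : ℕ) : ℝ) := by exact_mod_cast Nat.choose_pos hsle
  have hsqN : Real.sqrt N * Real.sqrt N = N := Real.mul_self_sqrt hNR0.le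
  obtain ⟨E, hE⟩ : ∃ e : ℝ, e = 8 * (Λ + 10) ^ 2 / (β ^ 4 * ((N : ℝ) - 1)) := ⟨_, rfl⟩
  rw [← hE] at hA
  have hexpE : 0 < Real.exp E := Real.exp_pos _
  have hCY0 : (0 : ℝ) ≤ ((aY.choose αs : ℕ) : ℝ) := Nat.cast_nonneg _
  have h8 : (0 : ℝ) < 8 * Real.sqrt N := by positivity
  have hA' : (((aY + mY).choose s : ℕ) : ℝ) ≤
      8 * Real.sqrt N * Real.exp E * (((aY.choose αs : ℕ) : ℝ) * ((mY.choose r : ℕ) : ℝ)) := by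
    have e : ((aY.choose αs * mY.choose (s - αs) : ℕ) : ℝ) =
        ((aY.choose αs : ℕ) : ℝ) * ((mY.choose r : ℕ) : ℝ) := by rw [← hr]; push_cast; ring
    rw [e] at hA
    have h := mul_le_mul_of_nonneg_right hA h8.le
    have e2 : (((aY + mY).choose s : ℕ) : ℝ) * (1 / (8 * Real.sqrt N)) * (8 * Real.sqrt N) =
        (((aY + mY).choose s : ℕ) : ℝ) := by field_simp
    rw [e2] at h
    linarith only [h]
  have hB' : ((mY.choose r : ℕ) : ℝ) ≤ 128 * Real.sqrt N * (hyperGen bY dY r).coeff y := by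
    have h := mul_le_mul_of_nonneg_right hB h8.le
    have e2 : ((mY.choose r : ℕ) : ℝ) * (1 / (8 * Real.sqrt N)) * (8 * Real.sqrt N) =
        ((mY.choose r : ℕ) : ℝ) := by field_simp
    rw [e2] at h
    linarith only [h]
  have hchain : (((aY + mY).choose s : ℕ) : ℝ) ≤
      2048 * (N : ℝ) ^ 2 * Real.exp E * shellLaw π S H (1 + 2 * s) 1 y₀ * (((aY + mY).choose s : ℕ) : ℝ) :=
    calc (((aY + mY).choose s : ℕ) : ℝ)
        ≤ 8 * Real.sqrt N * Real.exp E * (((aY.choose αs : ℕ) : ℝ) * ((mY.choose r : ℕ) : ℝ)) := hA'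
      _ ≤ 8 * Real.sqrt N * Real.exp E *
            (((aY.choose αs : ℕ) : ℝ) * (128 * Real.sqrt N * (hyperGen bY dY r).coeff y)) :=
          mul_le_mul_of_nonneg_left (mul_le_mul_of_nonneg_left hB' hCY0) (by positivity)
      _ = 1024 * (Real.sqrt N * Real.sqrt N) * Real.exp E *
            (((aY.choose αs : ℕ) : ℝ) * (hyperGen bY dY r).coeff y) := by ring
      _ ≤ 1024 * (Real.sqrt N * Real.sqrt N) * Real.exp E *
            (2 * N * (((aY + mY).choose s : ℕ) : ℝ) * shellLaw π S H (1 + 2 * s) 1 y₀) :=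
          mul_le_mul_of_nonneg_left hcomp (by positivity)
      _ = _ := by rw [hsqN]; ring
  have hone : 1 ≤ 2048 * (N : ℝ) ^ 2 * Real.exp E * shellLaw π S H (1 + 2 * s) 1 y₀ :=
    le_of_mul_le_mul_right (by rw [one_mul]; exact hchain) hCα0
  -- conclude
  rw [show -(8 * (Λ + 10) ^ 2 / (β ^ 4 * ((N : ℝ) - 1))) = -E by rw [hE], Real.exp_neg,
    div_le_iff₀ (by positivity)]
  calc (Real.exp E)⁻¹ = (Real.exp E)⁻¹ * 1 := by ring
    _ ≤ (Real.exp E)⁻¹ * (2048 * (N : ℝ) ^ 2 * Real.exp E * shellLaw π S H (1 + 2 * s) 1 y₀) :=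
        mul_le_mul_of_nonneg_left hone (inv_nonneg.2 hexpE.le)
    _ = shellLaw π S H (1 + 2 * s) 1 y₀ * (2048 * (N : ℝ) ^ 2) := by
        field_simp

end Main

end ShellStep

end Literature.Combinatorics.Optimization

end
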